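import Summits.AtomisticToContinuum.FouriersLaw.Theses.PhononMeanFreePath
import Summits.AtomisticToContinuum.FouriersLaw.Theorems.BoundaryKubo.Negative.LoadBearing
import Summits.AtomisticToContinuum.FouriersLaw.Theorems.PhononMeanFreePathBoundaryKuboGibbsTTCFAux1
import Summits.AtomisticToContinuum.FouriersLaw.Theorems.PhononMeanFreePathBoundaryKuboGibbsTTCFAux2

/-!
# The exact finite-time Gibbs-tested TTCF identity
(stub `stub_gibbsTTCF` of line `gibbs-ttcf`, crux stmt-AtomisticToContinuum-11812 `PhononMeanFreePath.BoundaryKubo`)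

For the pinned anharmonic chain `P = pinnedChain ω₂ lam β γ` (all four `> 0`) with `N + 1` sites `0..N`, `T > 0`,
`|δ| < 2T`, `S ≥ 0`, Gibbs measure `μ₀ = P.gibbsMeasure (N+1) T` and the CONSTRUCTED kernels
`K_s = P.transitionKernel (N+1) (T+δ/2) (T-δ/2) s` at the shifted bath temperatures:
`μ₀(K_S p_N²) - μ₀(p_N²) = δ (γ/2T²) ∫₀^S μ₀((p_0² - p_N²) · K_s p_N²) ds`.

Proof (Lebesgue duality engine). Write `ρ = e^{-H/T}`, `A = p_N²`, `W = p_0² - p_N²`, `P̂_s` the anti-friction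
reversed kernels. (1) `μ₀(g) = Z⁻¹ ∫ g ρ dx` (`integral_gibbsMeasure`), so it suffices to prove the identity for the
un-normalised weights. (2) Duality `∫ w ρ (K_s A) dx = e^{2γs} ∫ A · P̂_s(wρ) dy` for `w ∈ {1, W}`
(`pinnedChain_gibbs_duality`, helper 2; integrability from CEHR (3.4) and `e^{H/2T}ρ ∈ L¹`). (3) Pointwise in `y`:
`e^{2γS} P̂_S ρ(y) - ρ(y) = δ(γ/2T²) ∫₀^S e^{2γs} P̂_s(Wρ)(y) ds` (`gibbsDensity_langevinRevKernel_response`, helper 1: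
Dynkin for the energy cut-offs of `ρ` along the reversed equation, `L̂ρ = (-2γ + δ(γ/2T²)W)ρ`, integrating factor).
(4) Multiply by `A(y)`, integrate `dy`, and exchange `dy ds` (Fubini: the reversed kernels are jointly measurable in
`(s, y)` and `∫ A P̂_s(|W|ρ) dy = e^{-2γs} ∫ |W| ρ K_s A dx` is bounded on `[0, S]` by duality and (3.4)); duality
backwards gives the right-hand side. `S = 0`: both sides vanish (`K_0 = id`).
-/

noncomputable section

open scoped NNReal ENNReal Topology
open MeasureTheory Filter Set

namespace Summit.AtomisticToContinuum.FouriersLaw.Theorems.BoundaryKubo.GibbsTtcf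

open Literature.MathematicalPhysics.KineticTheory.HeatConduction
open Literature.MathematicalPhysics.KineticTheory Literature.Probability.Process OscillatorChain
open ProbabilityTheory
open Summit.AtomisticToContinuum.FouriersLaw.Theorems.SubdiffusiveBondHeat
open Summit.AtomisticToContinuum.FouriersLaw.Theorems.BoundaryKubo.Negative.LoadBearing
  (kuboIntegrand kuboValue LimitClause UniqueSteady SteadyFamily boundaryKubo_iff)

/-- **The Gibbs-tested TTCF identity for the un-normalised Gibbs weight** `ρ = e^{-H/T}` of the pinned chain
(`ω₂ > 0`, `lam, β, γ ≥ 0`, `N + 1` sites, `T > 0`, `|δ| < 2T`, `S ≥ 0`):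
`∫ (K_S p_N²) ρ dx - ∫ p_N² ρ dx = δ (γ/2T²) ∫₀^S ∫ (p_0² - p_N²) (K_s p_N²) ρ dx ds`,
`K_s = transitionKernel (N+1) (T+δ/2) (T-δ/2) s`. [folklore] -/
theorem pinnedChain_gibbsTTCF_density {ω₂ lam β γ : ℝ} (hω : 0 < ω₂) (hl : 0 ≤ lam) (hβ : 0 ≤ β) (hγ : 0 ≤ γ)
    (N : ℕ) {T δ : ℝ} (hT : 0 < T) (hδ : |δ| < 2 * T) {S : ℝ} (hS : 0 ≤ S) :
    (∫ x, (∫ y, (y.2 (Fin.last N)) ^ 2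
        ∂((pinnedChain ω₂ lam β γ).transitionKernel (N + 1) (T + δ / 2) (T - δ / 2) S.toNNReal x)) *
        (pinnedChain ω₂ lam β γ).gibbsDensity (N + 1) T x) -
      ∫ x, (x.2 (Fin.last N)) ^ 2 * (pinnedChain ω₂ lam β γ).gibbsDensity (N + 1) T x =
    δ * (γ / (2 * T ^ 2)) * ∫ s in (0 : ℝ)..S,
      ∫ x, ((x.2 0) ^ 2 - (x.2 (Fin.last N)) ^ 2) * (∫ y, (y.2 (Fin.last N)) ^ 2
        ∂((pinnedChain ω₂ lam β γ).transitionKernel (N + 1) (T + δ / 2) (T - δ / 2) s.toNNReal x)) *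
        (pinnedChain ω₂ lam β γ).gibbsDensity (N + 1) T x := by
  -- notation
  set P := pinnedChain ω₂ lam β γ with hPdef
  have hP : P.IsConfining := pinnedChain_isConfining hω hl hβ hγ
  have hM : 0 < N + 1 := Nat.succ_pos N
  have hδ' := abs_lt.1 hδ
  have ha : 0 < T + δ / 2 := by linarith [hδ'.1]
  have hb : 0 < T - δ / 2 := by linarith [hδ'.2]
  set ρ := P.gibbsDensity (N + 1) T with hρdef
  set A : PhaseSpace (N + 1) → ℝ := fun y => (y.2 (Fin.last N)) ^ 2 with hA
  set W : PhaseSpace (N + 1) → ℝ := fun x => (x.2 0) ^ 2 - (x.2 (Fin.last N)) ^ 2 with hW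
  set K : ℝ≥0 → Kernel (PhaseSpace (N + 1)) (PhaseSpace (N + 1)) :=
    P.transitionKernel (N + 1) (T + δ / 2) (T - δ / 2) with hK
  set Kr : ℝ≥0 → Kernel (PhaseSpace (N + 1)) (PhaseSpace (N + 1)) :=
    P.langevinRevKernel (N + 1) (T + δ / 2) (T - δ / 2) with hKr
  set c := γ / (2 * T ^ 2) with hc
  show (∫ x, (∫ y, A y ∂(K S.toNNReal x)) * ρ x) - ∫ x, A x * ρ x =
    δ * c * ∫ s in (0:ℝ)..S, ∫ x, (W x * ∫ y, A y ∂(K s.toNNReal x)) * ρ x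
  -- the exponent `θ = 1/(4T)`
  set θ : ℝ := 1 / (4 * T) with hθ
  have hθ0 : 0 < θ := by positivity
  have hmax : max (T + δ / 2) (T - δ / 2) < 2 * T := max_lt (by linarith [hδ'.2]) (by linarith [hδ'.1])
  have hmax0 : 0 < max (T + δ / 2) (T - δ / 2) := lt_max_of_lt_left ha
  have hθ' : θ < 1 / max (T + δ / 2) (T - δ / 2) :=
    calc θ < 1 / (2 * T) := by rw [hθ]; exact one_div_lt_one_div_of_lt (by positivity) (by linarith)
      _ < _ := one_div_lt_one_div_of_lt hmax0 hmax
  have h2θ : 2 * θ < 1 / T := by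
    rw [hθ, show 2 * (1 / (4 * T)) = 1 / (2 * T) by field_simp; ring]
    exact one_div_lt_one_div_of_lt hT (by linarith)
  have hθ1 : θ < 1 / T := by linarith
  -- continuity and exponential bounds of `A`, `W`, `1`
  have hAc : Continuous A := by rw [hA]; fun_prop
  have hWc : Continuous W := by rw [hW]; fun_prop
  have hρc : Continuous ρ := pinnedChain_continuous_gibbsDensity ω₂ lam β γ (N + 1) T
  have hρ0 : ∀ x, 0 ≤ ρ x := fun x => (P.gibbsDensity_pos (N + 1) T x).le
  have hA0 : ∀ y, 0 ≤ A y := fun y => sq_nonneg _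
  have hsq : ∀ (y : PhaseSpace (N + 1)) (i : Fin (N + 1)),
      |y.2 i ^ 2| ≤ 2 / θ * Real.exp (θ * P.hamiltonian (N + 1) y) := abs_sq_momentum_le_exp hP hθ0 (N + 1)
  have hAb : ∀ y, |A y| ≤ 2 / θ * Real.exp (θ * P.hamiltonian (N + 1) y) := fun y => hsq y _
  have hWb : ∀ x, |W x| ≤ 4 / θ * Real.exp (θ * P.hamiltonian (N + 1) x) := fun x =>
    calc |W x| ≤ |x.2 0 ^ 2| + |x.2 (Fin.last N) ^ 2| := abs_sub _ _
      _ ≤ 2 / θ * Real.exp (θ * P.hamiltonian (N + 1) x) + 2 / θ * Real.exp (θ * P.hamiltonian (N + 1) x) :=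
          add_le_add (hsq x _) (hsq x _)
      _ = 4 / θ * Real.exp (θ * P.hamiltonian (N + 1) x) := by ring
  have h1b : ∀ x : PhaseSpace (N + 1), |(1:ℝ)| ≤ 1 * Real.exp (θ * P.hamiltonian (N + 1) x) := fun x => by
    rw [abs_one, one_mul]
    exact Real.one_le_exp (mul_nonneg hθ0.le (hP.hamiltonian_nonneg (N + 1) x))
  -- the case `S = 0`: both sides vanish
  obtain rfl | hS0 := hS.eq_or_lt
  · have hK0 : K (Real.toNNReal 0) = Kernel.id := by
      rw [Real.toNNReal_zero]; exact pinnedChain_transitionKernel_zero hω hl hβ hγ (N + 1) _ _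
    rw [hK0, intervalIntegral.integral_same, mul_zero]
    simp only [Kernel.id_apply, integral_dirac, sub_self]
  -- the case `S > 0`
  set Sn := S.toNNReal with hSn
  have hSn0 : 0 < Sn := Real.toNNReal_pos.2 hS0
  have hSnc : ((Sn : ℝ≥0) : ℝ) = S := Real.coe_toNNReal _ hS
  set Φ : PhaseSpace (N + 1) → ℝ := fun y => ∫ x, ρ x ∂(Kr Sn y) with hΦ
  set Ψ : ℝ → PhaseSpace (N + 1) → ℝ := fun s y => ∫ x, W x * ρ x ∂(Kr s.toNNReal y) with hΨ
  -- (a) duality at time `S` with `w = 1`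
  obtain ⟨hi1, -, hd1⟩ := pinnedChain_gibbs_duality hω hl hβ hγ hM ha hb hT hθ0 hθ' h2θ continuous_const hAc
    h1b hAb hSn0
  simp only [abs_one, one_mul] at hi1 hd1
  rw [hSnc] at hd1
  have hLHS : ∫ x, (∫ y, A y ∂(K Sn x)) * ρ x = Real.exp (2 * γ * S) * ∫ y, A y * Φ y :=
    calc ∫ x, (∫ y, A y ∂(K Sn x)) * ρ x = ∫ x, ρ x * ∫ y, A y ∂(K Sn x) :=
          integral_congr_ae (Eventually.of_forall fun x => mul_comm _ _)
      _ = Real.exp (2 * γ * S) * ∫ y, A y * Φ y := hd1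
  -- (b) the pointwise response of the Gibbs density under the reversed kernels
  have hpt : ∀ y, Real.exp (2 * γ * S) * Φ y - ρ y =
      δ * c * ∫ s in (0:ℝ)..S, Real.exp (2 * γ * s) * Ψ s y :=
    fun y => gibbsDensity_langevinRevKernel_response hP hM hT hδ.le hS y
  -- (c) integrate against `A(y) dy`
  have hwt1 : Integrable (fun x => Real.exp (θ * P.hamiltonian (N + 1) x) * ρ x) :=
    pinnedChain_integrable_exp_mul_gibbsDensity hω hl hβ γ (N + 1) hT hθ1
  have hAρ : Integrable (fun y => A y * ρ y) :=
    (hwt1.const_mul (2 / θ)).mono' (hAc.mul hρc).aestronglyMeasurable (Eventually.of_forall fun y => by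
      rw [Real.norm_eq_abs, abs_mul, abs_of_nonneg (hρ0 y), ← mul_assoc]
      exact mul_le_mul_of_nonneg_right (hAb y) (hρ0 y))
  have hAΦ : Integrable (fun y => A y * Φ y) :=
    hi1.congr (Eventually.of_forall fun y => by
      show |A y| * (∫ x, ρ x ∂(Kr Sn y)) = A y * Φ y
      rw [abs_of_nonneg (hA0 y)])
  have hstep : (∫ x, (∫ y, A y ∂(K Sn x)) * ρ x) - ∫ x, A x * ρ x =
      δ * c * ∫ y, ∫ s in (0:ℝ)..S, A y * (Real.exp (2 * γ * s) * Ψ s y) := by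
    have e : ∀ y, Real.exp (2 * γ * S) * (A y * Φ y) - A y * ρ y =
        δ * c * ∫ s in (0:ℝ)..S, A y * (Real.exp (2 * γ * s) * Ψ s y) := by
      intro y
      rw [intervalIntegral.integral_const_mul]
      calc Real.exp (2 * γ * S) * (A y * Φ y) - A y * ρ y = A y * (Real.exp (2 * γ * S) * Φ y - ρ y) := by ring
        _ = A y * (δ * c * ∫ s in (0:ℝ)..S, Real.exp (2 * γ * s) * Ψ s y) := by rw [hpt y]
        _ = δ * c * (A y * ∫ s in (0:ℝ)..S, Real.exp (2 * γ * s) * Ψ s y) := by ring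
    rw [hLHS, ← integral_const_mul (Real.exp (2 * γ * S)), ← integral_sub (hAΦ.const_mul _) hAρ,
      ← integral_const_mul (δ * c)]
    exact integral_congr_ae (Eventually.of_forall e)
  -- (d) duality at the times `s > 0` with `w = W`
  have hdu : ∀ s : ℝ, 0 < s →
      Integrable (fun y => |A y| * ∫ x, |W x| * ρ x ∂(Kr s.toNNReal y)) ∧
      (∫ y, |A y| * ∫ x, |W x| * ρ x ∂(Kr s.toNNReal y)) ≤ Real.exp (-(2 * γ * s)) *
        (4 / θ * (2 / θ) * Real.exp (θ * γ * (T + δ / 2 + (T - δ / 2)) * s) *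
          ∫ x, Real.exp (2 * θ * P.hamiltonian (N + 1) x) * ρ x) ∧
      ∫ x, W x * ρ x * (∫ y, A y ∂(K s.toNNReal x)) = Real.exp (2 * γ * s) * ∫ y, A y * Ψ s y := by
    intro s hs
    have h := pinnedChain_gibbs_duality hω hl hβ hγ hM ha hb hT hθ0 hθ' h2θ hWc hAc hWb hAb
      (Real.toNNReal_pos.2 hs)
    rwa [Real.coe_toNNReal _ hs.le] at h
  -- (e) joint measurability of `(s, y) ↦ Ψ s y` and integrability of `G` on `(0, S] × Ω`
  have hΨm : StronglyMeasurable fun q : ℝ × PhaseSpace (N + 1) => Ψ q.1 q.2 :=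
    stronglyMeasurable_integral_langevinRevKernel hP (N + 1) (T + δ / 2) (T - δ / 2)
      (hWc.mul hρc).stronglyMeasurable
  set G : ℝ → PhaseSpace (N + 1) → ℝ := fun s y => A y * (Real.exp (2 * γ * s) * Ψ s y) with hG
  have hGm : StronglyMeasurable (Function.uncurry G) := by
    have h1 : StronglyMeasurable fun q : ℝ × PhaseSpace (N + 1) => A q.2 :=
      (hAc.comp continuous_snd).stronglyMeasurable
    have h2 : StronglyMeasurable fun q : ℝ × PhaseSpace (N + 1) => Real.exp (2 * γ * q.1) :=
      (Real.continuous_exp.comp ((continuous_const.mul continuous_id).comp continuous_fst)).stronglyMeasurable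
    exact h1.mul (h2.mul hΨm)
  set I₂ := ∫ x, Real.exp (2 * θ * P.hamiltonian (N + 1) x) * ρ x with hI₂
  have h2T : T + δ / 2 + (T - δ / 2) = 2 * T := by ring
  set Bd := 4 / θ * (2 / θ) * Real.exp (θ * γ * (T + δ / 2 + (T - δ / 2)) * S) * I₂ with hBd
  have hGs : ∀ s : ℝ, 0 < s → s ≤ S → Integrable (G s) ∧ ∫ y, ‖G s y‖ ≤ Bd := by
    intro s hs hsS
    obtain ⟨hi, hbd, -⟩ := hdu s hs
    have hΨs : StronglyMeasurable (Ψ s) :=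
      (hWc.mul hρc).stronglyMeasurable.integral_kernel (κ := Kr s.toNNReal)
    have hptw : ∀ y, ‖G s y‖ ≤ Real.exp (2 * γ * s) * (|A y| * ∫ x, |W x| * ρ x ∂(Kr s.toNNReal y)) := by
      intro y
      have h1 : ‖Ψ s y‖ ≤ ∫ x, |W x| * ρ x ∂(Kr s.toNNReal y) :=
        calc ‖Ψ s y‖ ≤ ∫ x, ‖W x * ρ x‖ ∂(Kr s.toNNReal y) := norm_integral_le_integral_norm _
          _ = ∫ x, |W x| * ρ x ∂(Kr s.toNNReal y) := integral_congr_ae (Eventually.of_forall fun x => by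
              show ‖W x * ρ x‖ = |W x| * ρ x
              rw [norm_mul, Real.norm_eq_abs, Real.norm_of_nonneg (hρ0 x)])
      show ‖A y * (Real.exp (2 * γ * s) * Ψ s y)‖ ≤ _
      rw [norm_mul, norm_mul, Real.norm_eq_abs, Real.norm_of_nonneg (Real.exp_pos _).le]
      calc |A y| * (Real.exp (2 * γ * s) * ‖Ψ s y‖) = Real.exp (2 * γ * s) * (|A y| * ‖Ψ s y‖) := by ring
        _ ≤ Real.exp (2 * γ * s) * (|A y| * ∫ x, |W x| * ρ x ∂(Kr s.toNNReal y)) :=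
            mul_le_mul_of_nonneg_left (mul_le_mul_of_nonneg_left h1 (abs_nonneg _)) (Real.exp_pos _).le
    have hint : Integrable (G s) := (hi.const_mul (Real.exp (2 * γ * s))).mono'
      (hAc.aestronglyMeasurable.mul ((continuous_const.aestronglyMeasurable).mul hΨs.aestronglyMeasurable))
      (Eventually.of_forall hptw)
    refine ⟨hint, ?_⟩
    have hI₂ : 0 ≤ I₂ := integral_nonneg fun x => mul_nonneg (Real.exp_pos _).le (hρ0 x)
    have hrate : 0 ≤ θ * γ * (T + δ / 2 + (T - δ / 2)) := by
      rw [h2T]; exact mul_nonneg (mul_nonneg hθ0.le hγ) (by linarith)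
    calc ∫ y, ‖G s y‖ ≤ ∫ y, Real.exp (2 * γ * s) * (|A y| * ∫ x, |W x| * ρ x ∂(Kr s.toNNReal y)) :=
          integral_mono hint.norm (hi.const_mul _) hptw
      _ = Real.exp (2 * γ * s) * ∫ y, |A y| * ∫ x, |W x| * ρ x ∂(Kr s.toNNReal y) := integral_const_mul _ _
      _ ≤ Real.exp (2 * γ * s) * (Real.exp (-(2 * γ * s)) *
          (4 / θ * (2 / θ) * Real.exp (θ * γ * (T + δ / 2 + (T - δ / 2)) * s) * I₂)) :=
          mul_le_mul_of_nonneg_left hbd (Real.exp_pos _).le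
      _ = 4 / θ * (2 / θ) * Real.exp (θ * γ * (T + δ / 2 + (T - δ / 2)) * s) * I₂ := by
          rw [← mul_assoc, ← Real.exp_add, show 2 * γ * s + -(2 * γ * s) = 0 by ring, Real.exp_zero, one_mul]
      _ ≤ Bd := by
          have hexp : Real.exp (θ * γ * (T + δ / 2 + (T - δ / 2)) * s) ≤
              Real.exp (θ * γ * (T + δ / 2 + (T - δ / 2)) * S) :=
            Real.exp_le_exp.2 (mul_le_mul_of_nonneg_left hsS hrate)
          exact mul_le_mul_of_nonneg_right (mul_le_mul_of_nonneg_left hexp (by positivity)) hI₂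
  have hGint : Integrable (Function.uncurry G) ((volume.restrict (Ioc 0 S)).prod volume) := by
    rw [integrable_prod_iff hGm.aestronglyMeasurable]
    constructor
    · exact (ae_restrict_iff' measurableSet_Ioc).2 (Eventually.of_forall fun s hs => (hGs s hs.1 hs.2).1)
    · refine Integrable.of_bound hGm.norm.aestronglyMeasurable.integral_prod_right' Bd ?_
      exact (ae_restrict_iff' measurableSet_Ioc).2 (Eventually.of_forall fun s hs => by
        rw [Real.norm_of_nonneg (integral_nonneg fun y => norm_nonneg _)]
        exact (hGs s hs.1 hs.2).2)
  -- (f) exchange the integrals and use duality backwards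
  rw [hstep]
  congr 1
  calc ∫ y, ∫ s in (0:ℝ)..S, A y * (Real.exp (2 * γ * s) * Ψ s y)
      = ∫ y, ∫ s in Ioc 0 S, G s y :=
        integral_congr_ae (Eventually.of_forall fun y => intervalIntegral.integral_of_le hS)
    _ = ∫ s in Ioc 0 S, ∫ y, G s y := (integral_integral_swap hGint).symm
    _ = ∫ s in Ioc 0 S, ∫ x, (W x * ∫ y, A y ∂(K s.toNNReal x)) * ρ x := by
        refine setIntegral_congr_fun measurableSet_Ioc fun s hs => ?_
        obtain ⟨-, -, hd⟩ := hdu s hs.1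
        calc ∫ y, G s y = ∫ y, Real.exp (2 * γ * s) * (A y * Ψ s y) :=
              integral_congr_ae (Eventually.of_forall fun y => by
                show A y * (Real.exp (2 * γ * s) * Ψ s y) = Real.exp (2 * γ * s) * (A y * Ψ s y); ring)
          _ = Real.exp (2 * γ * s) * ∫ y, A y * Ψ s y := integral_const_mul _ _
          _ = ∫ x, W x * ρ x * ∫ y, A y ∂(K s.toNNReal x) := hd.symm
          _ = ∫ x, (W x * ∫ y, A y ∂(K s.toNNReal x)) * ρ x :=
              integral_congr_ae (Eventually.of_forall fun x => by
                show W x * ρ x * (∫ y, A y ∂(K s.toNNReal x)) = (W x * ∫ y, A y ∂(K s.toNNReal x)) * ρ x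
                ring)
    _ = ∫ s in (0:ℝ)..S, ∫ x, (W x * ∫ y, A y ∂(K s.toNNReal x)) * ρ x :=
        (intervalIntegral.integral_of_le hS).symm

/-- **STUB `stub_gibbsTTCF` of line `gibbs-ttcf` (crux `PhononMeanFreePath.BoundaryKubo`): the EXACT finite-time,
finite-`δ` Gibbs-tested transient time-correlation identity** for the end kinetic temperature of the pinned anharmonic
chain with `N + 1` sites: for `T > 0`, `|δ| < 2T`, `S ≥ 0`, `μ₀ = gibbsMeasure (N+1) T` and the constructed kernels
`K^δ_s = transitionKernel (N+1) (T+δ/2) (T-δ/2) s`,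
`μ₀(K^δ_S p_N²) - μ₀(p_N²) = δ (γ/2T²) ∫₀^S μ₀((p_0² - p_N²) · K^δ_s p_N²) ds`
(Lebesgue duality of the Langevin kernels, Dynkin for the Gibbs density along the reversed equation with
`L̂_δ ρ_T = (-2γ + δ(γ/2T²)(p_0² - p_N²)) ρ_T`, integrating factor `e^{2γs}`, Fubini). [folklore] -/
theorem stub_gibbsTTCF :
    ∀ ω₂ lam β γ : ℝ, 0 < ω₂ → 0 < lam → 0 < β → 0 < γ → ∀ (N : ℕ) (T : ℝ), 0 < T →
      ∀ δ : ℝ, |δ| < 2 * T → ∀ S : ℝ, 0 ≤ S →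
        (∫ z, (∫ y, (y.2 (Fin.last N)) ^ 2
            ∂((pinnedChain ω₂ lam β γ).transitionKernel (N + 1) (T + δ / 2) (T - δ / 2) S.toNNReal z))
            ∂((pinnedChain ω₂ lam β γ).gibbsMeasure (N + 1) T)) -
          (∫ z, (z.2 (Fin.last N)) ^ 2 ∂((pinnedChain ω₂ lam β γ).gibbsMeasure (N + 1) T)) =
        δ * (γ / (2 * T ^ 2)) *
          ∫ s in (0 : ℝ)..S, ∫ z, ((z.2 0) ^ 2 - (z.2 (Fin.last N)) ^ 2) *
            (∫ y, (y.2 (Fin.last N)) ^ 2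
              ∂((pinnedChain ω₂ lam β γ).transitionKernel (N + 1) (T + δ / 2) (T - δ / 2) s.toNNReal z))
            ∂((pinnedChain ω₂ lam β γ).gibbsMeasure (N + 1) T) := by
  intro ω₂ lam β γ hω hl hβ hγ N T hT δ hδ S hS
  simp_rw [OscillatorChain.integral_gibbsMeasure]
  rw [intervalIntegral.integral_const_mul, ← mul_sub,
    pinnedChain_gibbsTTCF_density hω hl.le hβ.le hγ.le N hT hδ hS]
  ring

end Summit.AtomisticToContinuum.FouriersLaw.Theorems.BoundaryKubo.GibbsTtcf

end
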